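import Summits.BirchSwinnertonDyer.BirchSwinnertonDyer.Theorems.KolyvaginDepthDoorKolyvaginDepthSupplyDoorNoTwistTwistSelmer
import HarnessLib

/-!
# Route `KolyvaginDepthDoor`, crux `KolyvaginDepthSupply` (stmt-BirchSwinnertonDyer-21765) —
# the twist-free door at ANY DEPTH `ν` with every Euler-system input by name (beyond the rank-2 table)

Helper file (`--supports stmt-BirchSwinnertonDyer-21765 --as helper`); it closes nothing and BSD is
not proved by it.

`…DoorNoTwistOfPrint` / `…DoorNoTwistTwistSelmer` state the named-McCallum-facts ("print") versions of
the twist-free door only for the rank-2 slice (one Kolyvagin prime `ℓ`, depth `1`). The system-level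
theorems are already general in the depth (`shaCorank_eq_zero_of_kolyvaginClass_ne_zero_of_rank_le_of_system`,
`natCard_selmerGroup_twist_le_of_hypothesesDepth`). This file records the general-depth statements the
higher-rank rows need (rank `3`: a square-free product `n₁ = ℓ₁ℓ₂` of TWO Kolyvagin primes, depth `2`):

* `natCard_selmerGroup_twist_le_of_kolyvaginClass_ne_zero_of_system` (general depth) —
  `(d n₁).kolyvaginClass hp 1 ≠ 0` at depth `ν₁`, `ν₁ + 1 ≤ rank E(ℚ)` ⟹ `#Sel^(p)(E^{(d_K)}/ℚ) ≤ p^{ν₁}`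
  and the descent count on the twist;
* `shaCorank_eq_zero_of_kolyvaginClass_ne_zero_of_rank_le_of_print`,
  `natCard_selmerGroup_twist_le_of_kolyvaginClass_ne_zero_of_print` — the same two with the six
  system hypotheses DISCHARGED BY NAME from the McCallum 1991 facts (compatible system `hσ`, `hS₁`, `hS₂`,
  `hemb`), exactly as in `…DoorOfPrint`.

Trust base: five named McCallum/Gross leaves, compatible system, bit; NO twist point, NO Kolyvagin
Thm. 4, no `p ≥ 5`. Per-curve; BSD is not proved by it.

References: [Kolyvagin1991MathAnn] Thm. 2.3; [GrossLMS1991] §5 (5.1), §10; [McCallumLMS1991] §§2–5.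
-/

set_option linter.dupNamespace false

noncomputable section

open scoped Classical

namespace Summit.BirchSwinnertonDyer.BirchSwinnertonDyer.Theorems.KolyvaginDepthDoor

open Literature.NumberTheory.EllipticCurves Literature.NumberTheory.EllipticCurves.ModularForms
  Literature.NumberTheory.EllipticCurves.KolyvaginDescent
  Literature.NumberTheory.EllipticCurves.McCallum1991 WeierstrassCurve NumberField IsDedekindDomain

variable {W : WeierstrassCurve ℚ} [W.IsElliptic] [W.IsGloballyMinimal] [NeZero (W.conductorNorm ℤ)]
  {K : Type} [Field K] [NumberField K]
  {Dt : ModularParametrizationData W (W.conductorNorm ℤ)} {β : ℤ} {ι : K →+* ℂ}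

/-! ## The twist bound on the crux's objects, any depth -/

/-- **`#Sel_p(E^{(d_K)}/ℚ) ≤ p^{ν₁}` on the crux's objects, any depth, no twist point.** In the setting of
`exists_hypothesesDepth_of_system`: `(d n₁).kolyvaginClass hp 1 ≠ 0` at a square-free product `n₁` of
Kolyvagin primes with `ν₁` prime factors and `ν₁ + 1 ≤ rank E(ℚ)` give `Sel^(p)(E^{(d_K)}/ℚ)` finite of
order `≤ p^{ν₁}` (index `p^1`) and `p^{rank E^{(d_K)}} · #E^{(d_K)}(ℚ)[p] · #Ш(E^{(d_K)}/ℚ)[p] ≤ p^{ν₁}`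
(`natCard_selmerGroup_twist_le_of_hypothesesDepth` at `m = p^1`). CONDITIONAL on the displayed
hypotheses; per-curve; BSD is not proved by it. [cite: Kolyvagin1991MathAnn, Thm. 2.3]
[cite: GrossLMS1991, §5 (5.1) and §10] -/
theorem natCard_selmerGroup_twist_le_of_kolyvaginClass_ne_zero_of_system (hcm : ¬ W.HasCM)
    (hK : IsImaginaryQuadratic K) (p : ℕ) [hp : Fact p.Prime] (hp2 : p ≠ 2)
    (htower : ∀ n : ℕ, W.HasSurjectiveModNGaloisRep (p ^ n : ℕ))
    (c : K ≃ₐ[ℚ] K) (hc : c ≠ 1) (hcc : c * c = 1)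
    (d : ∀ n : ℕ, KolyvaginHeegnerData Dt β ι n) (ε : ℤ) (hε : ε = 1 ∨ ε = -1)
    (hτc : ∀ n : ℕ, Squarefree n →
      (∀ q ∈ n.primeFactors, Zhang2014.IsKolyvaginPrime (W.conductorNorm ℤ) W K p q) →
      conjAct W c ((p ^ 1 : ℕ) : ℤ) ((d n).kolyvaginClass hp.out 1) =
        (ε * (-1) ^ n.primeFactors.card) • (d n).kolyvaginClass hp.out 1)
    (hfin : ∀ n : ℕ, Squarefree n →
      (∀ q ∈ n.primeFactors, Zhang2014.IsKolyvaginPrime (W.conductorNorm ℤ) W K p q) →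
      ∀ v : HeightOneSpectrum (𝓞 K), (n : 𝓞 K) ∉ v.asIdeal →
        (d n).kolyvaginClass hp.out 1 ∈
          selmerLocalKer (W.baseChange K) (v.adicCompletion K) ((p ^ 1 : ℕ) : ℤ))
    (hinf : ∀ n : ℕ, Squarefree n →
      (∀ q ∈ n.primeFactors, Zhang2014.IsKolyvaginPrime (W.conductorNorm ℤ) W K p q) →
      ∀ w : InfinitePlace K,
        (d n).kolyvaginClass hp.out 1 ∈ selmerLocalKer (W.baseChange K) w.Completion ((p ^ 1 : ℕ) : ℤ))
    (h44 : ∀ (ℓ m : ℕ), Squarefree (ℓ * m) →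
      (∀ q ∈ (ℓ * m).primeFactors, Zhang2014.IsKolyvaginPrime (W.conductorNorm ℤ) W K p q) →
      Zhang2014.IsKolyvaginPrime (W.conductorNorm ℤ) W K p ℓ →
      ∀ v : HeightOneSpectrum (𝓞 K), (ℓ : 𝓞 K) ∈ v.asIdeal →
        ((d (ℓ * m)).kolyvaginClass hp.out 1 ∈
            selmerLocalKer (W.baseChange K) (v.adicCompletion K) ((p ^ 1 : ℕ) : ℤ) ↔
          (d m).kolyvaginClass hp.out 1 ∈
            (W.baseChange K).torsionLocalKer (v.adicCompletion K) ((p ^ 1 : ℕ) : ℤ)))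
    (hcyc : ∀ ℓ : ℕ, Zhang2014.IsKolyvaginPrime (W.conductorNorm ℤ) W K p ℓ →
      ∀ e : ℤ, (e = 1 ∨ e = -1) →
      ∀ s₁ ∈ selmerGroup (W.baseChange K) ((p ^ 1 : ℕ) : ℤ),
        conjAct W c ((p ^ 1 : ℕ) : ℤ) s₁ = e • s₁ →
      ∀ s₂ ∈ selmerGroup (W.baseChange K) ((p ^ 1 : ℕ) : ℤ),
        conjAct W c ((p ^ 1 : ℕ) : ℤ) s₂ = e • s₂ →
      ∃ a b : ℤ, ¬ ((p : ℤ) ∣ a ∧ (p : ℤ) ∣ b) ∧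
        ∀ v : HeightOneSpectrum (𝓞 K), (ℓ : 𝓞 K) ∈ v.asIdeal →
          a • s₁ + b • s₂ ∈ (W.baseChange K).torsionLocalKer (v.adicCompletion K) ((p ^ 1 : ℕ) : ℤ))
    (hdual : ∀ (T : Finset ℕ), (∀ q ∈ T, Zhang2014.IsKolyvaginPrime (W.conductorNorm ℤ) W K p q) →
      ∀ ℓ ∈ T, ∀ e : ℤ, (e = 1 ∨ e = -1) →
      ∀ x : galH1Torsion (W.baseChange K) ((p ^ 1 : ℕ) : ℤ),
        conjAct W c ((p ^ 1 : ℕ) : ℤ) x = e • x →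
        (∀ v : HeightOneSpectrum (𝓞 K), (∀ q ∈ T, (q : 𝓞 K) ∉ v.asIdeal) →
          x ∈ selmerLocalKer (W.baseChange K) (v.adicCompletion K) ((p ^ 1 : ℕ) : ℤ)) →
        (∀ w : InfinitePlace K, x ∈ selmerLocalKer (W.baseChange K) w.Completion ((p ^ 1 : ℕ) : ℤ)) →
      ∀ s ∈ selmerGroup (W.baseChange K) ((p ^ 1 : ℕ) : ℤ),
        conjAct W c ((p ^ 1 : ℕ) : ℤ) s = e • s →
        (∀ q ∈ T, q ≠ ℓ → ∀ v : HeightOneSpectrum (𝓞 K), (q : 𝓞 K) ∈ v.asIdeal →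
          s ∈ (W.baseChange K).torsionLocalKer (v.adicCompletion K) ((p ^ 1 : ℕ) : ℤ)) →
        ∀ v : HeightOneSpectrum (𝓞 K), (ℓ : 𝓞 K) ∈ v.asIdeal →
          s ∉ (W.baseChange K).torsionLocalKer (v.adicCompletion K) ((p ^ 1 : ℕ) : ℤ) →
          x ∈ selmerLocalKer (W.baseChange K) (v.adicCompletion K) ((p ^ 1 : ℕ) : ℤ))
    {n₁ : ℕ} (hn₁ : Squarefree n₁)
    (hk₁ : ∀ q ∈ n₁.primeFactors, Zhang2014.IsKolyvaginPrime (W.conductorNorm ℤ) W K p q)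
    (hne : (d n₁).kolyvaginClass hp.out 1 ≠ 0) (hrank : n₁.primeFactors.card + 1 ≤ W.mordellWeilRank) :
    Finite ↥(selmerGroup (W.quadraticTwist (NumberField.discr K : ℚ)) ((p ^ 1 : ℕ) : ℤ)) ∧
      Nat.card ↥(selmerGroup (W.quadraticTwist (NumberField.discr K : ℚ)) ((p ^ 1 : ℕ) : ℤ)) ≤
        p ^ n₁.primeFactors.card ∧
      p ^ (W.quadraticTwist (NumberField.discr K : ℚ)).mordellWeilRank *
          Nat.card ↥(AddSubgroup.torsionBy (W.quadraticTwist (NumberField.discr K : ℚ)).toAffine.Point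
            ((p ^ 1 : ℕ) : ℤ)) *
          Nat.card ↥((W.quadraticTwist (NumberField.discr K : ℚ)).sha ⊓
            AddSubgroup.torsionBy (W.quadraticTwist (NumberField.discr K : ℚ)).galH1
              ((p ^ 1 : ℕ) : ℤ)) ≤ p ^ n₁.primeFactors.card := by
  obtain ⟨S, hSel, hSp, hSc, hSK, hSτ⟩ := exists_hypothesesDepth_of_system hcm hK p hp2 htower c hc
    hcc d ε hε hτc hfin hinf h44 hcyc hdual
  have hsupp : KolSupp S.Kol n₁ := by rw [hSK]; exact ⟨hn₁, hk₁⟩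
  have hne' : S.c n₁ ≠ 0 := by rw [hSc]; exact hne
  exact natCard_selmerGroup_twist_le_of_hypothesesDepth W K hK.1 c hc p hp2 (pow_one p) S hSel hSp hSτ
    hsupp hne' hrank

/-! ## Every Euler-system input by name, any depth -/

/-- **The twist-free door at any depth, all Euler-system inputs named.** `E/ℚ` globally minimal without
CM, `K` imaginary quadratic Heegner with `d_K ∉ {−3, −4}`, `p` odd with `ρ̄_{E,p^n}` onto for all `n`, a
COMPATIBLE system `d` (`hσ`, `hS₁`, `hS₂`, `hemb`), the five named McCallum facts; `(d n₁).kolyvaginClass hp 1 ≠ 0`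
at a square-free product `n₁` of Kolyvagin primes (Zhang's form) with `ν₁` prime factors, and
`ν₁ + 1 ≤ rank E(ℚ)`. Then `corank_{ℤ_p} Ш(E/ℚ)[p^∞] = 0`, `rank E(ℚ) = ν₁ + 1`, `rank E^{(d_K)}(ℚ) ≤ ν₁`,
`E(ℚ)[p] = 0`, `Ш(E/ℚ)[p] = 0`, `#Sel^(p)(E/ℚ) = p^{ν₁+1}` (index `p^1`). CONDITIONAL on the five named facts;
per-curve; BSD is not proved by it. [cite: Kolyvagin1991MathAnn, Thm. 2.3] [cite: McCallumLMS1991, §§2–5]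
[cite: GrossLMS1991, §5 (5.1) and §10] -/
theorem shaCorank_eq_zero_of_kolyvaginClass_ne_zero_of_rank_le_of_print
    (h54 : sign_conjAct_kolyvaginClass) (h43 : lemma43_kolyvaginClass_mem_selmerLocalKer)
    (h44 : prop44_localOrder_kolyvaginClass_mul_eq) (h53 : lemma53_selmer_eigen_dependent_at)
    (h22 : prop22_reciprocity_eigen_finset)
    (hcm : ¬ W.HasCM) (hK : IsImaginaryQuadratic K) (hD3 : NumberField.discr K ≠ -3)
    (hD4 : NumberField.discr K ≠ -4) (hH : SatisfiesHeegnerHypothesis (W.conductorNorm ℤ) K)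
    (p : ℕ) [hp : Fact p.Prime] (hp2 : p ≠ 2)
    (htower : ∀ n : ℕ, W.HasSurjectiveModNGaloisRep (p ^ n : ℕ))
    (c : K ≃ₐ[ℚ] K) (hc : c ≠ 1) (hcc : c * c = 1)
    (d : ∀ n : ℕ, KolyvaginHeegnerData Dt β ι n)
    (hσ : ∀ (m l : ℕ), ∀ l' ∈ m.primeFactors, ∀ (x : ringClassField K ι m)
      (x' : ringClassField K ι (m * l)),
      (x : ℂ) = x' → (((d (m * l)).σ l' x' : ringClassField K ι (m * l)) : ℂ) = ((d m).σ l' x : ℂ))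
    (hS₁ : ∀ (m l : ℕ), ∀ s ∈ (d m).S, ∃ s' ∈ (d (m * l)).S, ∀ (x : ringClassField K ι m)
      (x' : ringClassField K ι (m * l)),
      (x : ℂ) = x' → ((s' x' : ringClassField K ι (m * l)) : ℂ) = (s x : ℂ))
    (hS₂ : ∀ (m l : ℕ), ∀ s' ∈ (d (m * l)).S, ∃ s ∈ (d m).S, ∀ (x : ringClassField K ι m)
      (x' : ringClassField K ι (m * l)),
      (x : ℂ) = x' → ((s' x' : ringClassField K ι (m * l)) : ℂ) = (s x : ℂ))
    (hemb : ∀ (m l : ℕ) (x : ringClassField K ι m) (x' : ringClassField K ι (m * l)),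
      (x : ℂ) = x' → (d (m * l)).emb x' = (d m).emb x)
    {n₁ : ℕ} (hn₁ : Squarefree n₁)
    (hk₁ : ∀ q ∈ n₁.primeFactors, Zhang2014.IsKolyvaginPrime (W.conductorNorm ℤ) W K p q)
    (hne : (d n₁).kolyvaginClass hp.out 1 ≠ 0) (hrank : n₁.primeFactors.card + 1 ≤ W.mordellWeilRank) :
    W.shaCorank p = 0 ∧ W.mordellWeilRank = n₁.primeFactors.card + 1 ∧
      (W.quadraticTwist (NumberField.discr K : ℚ)).mordellWeilRank ≤ n₁.primeFactors.card ∧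
      Nat.card ↥(AddSubgroup.torsionBy W.toAffine.Point ((p ^ 1 : ℕ) : ℤ)) = 1 ∧
      W.sha ⊓ AddSubgroup.torsionBy W.galH1 ((p ^ 1 : ℕ) : ℤ) = ⊥ ∧
      Nat.card ↥(selmerGroup W ((p ^ 1 : ℕ) : ℤ)) = p ^ (n₁.primeFactors.card + 1) := by
  -- `ℓ' ∈ S₁(1)` for every Kolyvagin prime (Zhang's `0 < M(ℓ')`)
  have hS1 : ∀ {n : ℕ}, (∀ q ∈ n.primeFactors, Zhang2014.IsKolyvaginPrime (W.conductorNorm ℤ) W K p q) →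
      ∀ q ∈ n.primeFactors, Zhang2014.IsKolyvaginPrime (W.conductorNorm ℤ) W K p q ∧
        1 ≤ Zhang2014.kolyvaginIndex W p q :=
    fun h q hq ↦ ⟨h q hq, (h q hq).2.2.2.2.2⟩
  -- the sign law (Gross Prop. 5.4 (2))
  obtain ⟨ε, hε, hsign⟩ := h54 W hcm K hK hD3 hD4 hH p hp2 htower c hc Dt β ι 1 le_rfl
  refine shaCorank_eq_zero_of_kolyvaginClass_ne_zero_of_rank_le_of_system hcm hK p hp2
    htower c hc hcc d ε hε (fun n hn hk ↦ hsign n hn (hS1 hk) (d n))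
    (fun n hn hk v hv ↦ (h43 W hcm K hK hD3 hD4 hH p hp2 htower Dt β ι 1 le_rfl n hn (hS1 hk)
      (d n)).1 v hv)
    (fun n hn hk w ↦ (h43 W hcm K hK hD3 hD4 hH p hp2 htower Dt β ι 1 le_rfl n hn (hS1 hk)
      (d n)).2 w)
    (fun l m hsq hk hl v hv ↦ ?_)
    (fun l hl e he s₁ hs₁ hτ₁ s₂ hs₂ hτ₂ ↦ h53 W hcm K hK p hp2 htower c hc 1 le_rfl l hl
      hl.2.2.2.2.2 e he s₁ hs₁ hτ₁ s₂ hs₂ hτ₂)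
    (fun T hT l hlT e he x hx hoff hinf s hs hτs hsT v hv hsv ↦
      mem_selmerLocalKer_of_not_mem_torsionLocalKer_of_prop22 h22 W hcm K hK p hp2 htower c hc T hT
        hlT e he x hx hoff hinf s hs hτs hsT v hv hsv)
    hn₁ hk₁ hne hrank
  -- `h44`: McCallum Prop. 4.4 "in particular" for the compatible pair `(d m, d (m l))`
  have hsq' : Squarefree (m * l) := by rwa [Nat.mul_comm] at hsq
  have hk' : ∀ q ∈ (m * l).primeFactors, Zhang2014.IsKolyvaginPrime (W.conductorNorm ℤ) W K p q ∧
      1 ≤ Zhang2014.kolyvaginIndex W p q := by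
    rw [Nat.mul_comm]
    exact hS1 hk
  have hlm : ¬ l ∣ m := by
    intro hdiv
    have hll : l * l ∣ l * m := Nat.mul_dvd_mul_left l hdiv
    exact hl.1.not_isUnit (hsq l hll)
  have hA := kolyvaginClass_mul_mem_selmerLocalKer_iff_of_prop44 h44 W hcm K hK hD3 hD4 hH p hp2
    htower Dt β ι 1 le_rfl m l hsq' hl.1 hlm hk' (d m) (d (m * l)) (hσ m l) (hS₁ m l) (hS₂ m l)
    (hemb m l) v hv
  have hB := kolyvaginClass_mul_mem_torsionLocalKer_iff_of_prop44 h44 W hcm K hK hD3 hD4 hH p hp2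
    htower Dt β ι 1 le_rfl m l hsq' hl.1 hlm hk' (d m) (d (m * l)) (hσ m l) (hS₁ m l) (hS₂ m l)
    (hemb m l) v hv
  have hAB : (d (m * l)).kolyvaginClass (Fact.out : p.Prime) 1 ∈
        selmerLocalKer (W.baseChange K) (v.adicCompletion K) ((p ^ 1 : ℕ) : ℤ) ↔
      (d m).kolyvaginClass (Fact.out : p.Prime) 1 ∈
        (W.baseChange K).torsionLocalKer (v.adicCompletion K) ((p ^ 1 : ℕ) : ℤ) := hA.trans hB
  rw [Nat.mul_comm m l] at hAB
  exact hAB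

/-- **The twist bound at any depth, all Euler-system inputs named**: same hypotheses;
`#Sel^(p)(E^{(d_K)}/ℚ) ≤ p^{ν₁}` and `p^{rank E^{(d_K)}} · #E^{(d_K)}(ℚ)[p] · #Ш(E^{(d_K)}/ℚ)[p] ≤ p^{ν₁}`.
CONDITIONAL on the five named facts; per-curve; BSD is not proved by it.
[cite: Kolyvagin1991MathAnn, Thm. 2.3] [cite: McCallumLMS1991, §§2–5] [cite: GrossLMS1991, §5 (5.1)] -/
theorem natCard_selmerGroup_twist_le_of_kolyvaginClass_ne_zero_of_print
    (h54 : sign_conjAct_kolyvaginClass) (h43 : lemma43_kolyvaginClass_mem_selmerLocalKer)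
    (h44 : prop44_localOrder_kolyvaginClass_mul_eq) (h53 : lemma53_selmer_eigen_dependent_at)
    (h22 : prop22_reciprocity_eigen_finset)
    (hcm : ¬ W.HasCM) (hK : IsImaginaryQuadratic K) (hD3 : NumberField.discr K ≠ -3)
    (hD4 : NumberField.discr K ≠ -4) (hH : SatisfiesHeegnerHypothesis (W.conductorNorm ℤ) K)
    (p : ℕ) [hp : Fact p.Prime] (hp2 : p ≠ 2)
    (htower : ∀ n : ℕ, W.HasSurjectiveModNGaloisRep (p ^ n : ℕ))
    (c : K ≃ₐ[ℚ] K) (hc : c ≠ 1) (hcc : c * c = 1)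
    (d : ∀ n : ℕ, KolyvaginHeegnerData Dt β ι n)
    (hσ : ∀ (m l : ℕ), ∀ l' ∈ m.primeFactors, ∀ (x : ringClassField K ι m)
      (x' : ringClassField K ι (m * l)),
      (x : ℂ) = x' → (((d (m * l)).σ l' x' : ringClassField K ι (m * l)) : ℂ) = ((d m).σ l' x : ℂ))
    (hS₁ : ∀ (m l : ℕ), ∀ s ∈ (d m).S, ∃ s' ∈ (d (m * l)).S, ∀ (x : ringClassField K ι m)
      (x' : ringClassField K ι (m * l)),
      (x : ℂ) = x' → ((s' x' : ringClassField K ι (m * l)) : ℂ) = (s x : ℂ))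
    (hS₂ : ∀ (m l : ℕ), ∀ s' ∈ (d (m * l)).S, ∃ s ∈ (d m).S, ∀ (x : ringClassField K ι m)
      (x' : ringClassField K ι (m * l)),
      (x : ℂ) = x' → ((s' x' : ringClassField K ι (m * l)) : ℂ) = (s x : ℂ))
    (hemb : ∀ (m l : ℕ) (x : ringClassField K ι m) (x' : ringClassField K ι (m * l)),
      (x : ℂ) = x' → (d (m * l)).emb x' = (d m).emb x)
    {n₁ : ℕ} (hn₁ : Squarefree n₁)
    (hk₁ : ∀ q ∈ n₁.primeFactors, Zhang2014.IsKolyvaginPrime (W.conductorNorm ℤ) W K p q)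
    (hne : (d n₁).kolyvaginClass hp.out 1 ≠ 0) (hrank : n₁.primeFactors.card + 1 ≤ W.mordellWeilRank) :
    Finite ↥(selmerGroup (W.quadraticTwist (NumberField.discr K : ℚ)) ((p ^ 1 : ℕ) : ℤ)) ∧
      Nat.card ↥(selmerGroup (W.quadraticTwist (NumberField.discr K : ℚ)) ((p ^ 1 : ℕ) : ℤ)) ≤
        p ^ n₁.primeFactors.card ∧
      p ^ (W.quadraticTwist (NumberField.discr K : ℚ)).mordellWeilRank *
          Nat.card ↥(AddSubgroup.torsionBy (W.quadraticTwist (NumberField.discr K : ℚ)).toAffine.Point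
            ((p ^ 1 : ℕ) : ℤ)) *
          Nat.card ↥((W.quadraticTwist (NumberField.discr K : ℚ)).sha ⊓
            AddSubgroup.torsionBy (W.quadraticTwist (NumberField.discr K : ℚ)).galH1
              ((p ^ 1 : ℕ) : ℤ)) ≤ p ^ n₁.primeFactors.card := by
  -- `ℓ' ∈ S₁(1)` for every Kolyvagin prime (Zhang's `0 < M(ℓ')`)
  have hS1 : ∀ {n : ℕ}, (∀ q ∈ n.primeFactors, Zhang2014.IsKolyvaginPrime (W.conductorNorm ℤ) W K p q) →
      ∀ q ∈ n.primeFactors, Zhang2014.IsKolyvaginPrime (W.conductorNorm ℤ) W K p q ∧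
        1 ≤ Zhang2014.kolyvaginIndex W p q :=
    fun h q hq ↦ ⟨h q hq, (h q hq).2.2.2.2.2⟩
  -- the sign law (Gross Prop. 5.4 (2))
  obtain ⟨ε, hε, hsign⟩ := h54 W hcm K hK hD3 hD4 hH p hp2 htower c hc Dt β ι 1 le_rfl
  refine natCard_selmerGroup_twist_le_of_kolyvaginClass_ne_zero_of_system hcm hK p hp2
    htower c hc hcc d ε hε (fun n hn hk ↦ hsign n hn (hS1 hk) (d n))
    (fun n hn hk v hv ↦ (h43 W hcm K hK hD3 hD4 hH p hp2 htower Dt β ι 1 le_rfl n hn (hS1 hk)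
      (d n)).1 v hv)
    (fun n hn hk w ↦ (h43 W hcm K hK hD3 hD4 hH p hp2 htower Dt β ι 1 le_rfl n hn (hS1 hk)
      (d n)).2 w)
    (fun l m hsq hk hl v hv ↦ ?_)
    (fun l hl e he s₁ hs₁ hτ₁ s₂ hs₂ hτ₂ ↦ h53 W hcm K hK p hp2 htower c hc 1 le_rfl l hl
      hl.2.2.2.2.2 e he s₁ hs₁ hτ₁ s₂ hs₂ hτ₂)
    (fun T hT l hlT e he x hx hoff hinf s hs hτs hsT v hv hsv ↦
      mem_selmerLocalKer_of_not_mem_torsionLocalKer_of_prop22 h22 W hcm K hK p hp2 htower c hc T hT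
        hlT e he x hx hoff hinf s hs hτs hsT v hv hsv)
    hn₁ hk₁ hne hrank
  -- `h44`: McCallum Prop. 4.4 "in particular" for the compatible pair `(d m, d (m l))`
  have hsq' : Squarefree (m * l) := by rwa [Nat.mul_comm] at hsq
  have hk' : ∀ q ∈ (m * l).primeFactors, Zhang2014.IsKolyvaginPrime (W.conductorNorm ℤ) W K p q ∧
      1 ≤ Zhang2014.kolyvaginIndex W p q := by
    rw [Nat.mul_comm]
    exact hS1 hk
  have hlm : ¬ l ∣ m := by
    intro hdiv
    have hll : l * l ∣ l * m := Nat.mul_dvd_mul_left l hdiv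
    exact hl.1.not_isUnit (hsq l hll)
  have hA := kolyvaginClass_mul_mem_selmerLocalKer_iff_of_prop44 h44 W hcm K hK hD3 hD4 hH p hp2
    htower Dt β ι 1 le_rfl m l hsq' hl.1 hlm hk' (d m) (d (m * l)) (hσ m l) (hS₁ m l) (hS₂ m l)
    (hemb m l) v hv
  have hB := kolyvaginClass_mul_mem_torsionLocalKer_iff_of_prop44 h44 W hcm K hK hD3 hD4 hH p hp2
    htower Dt β ι 1 le_rfl m l hsq' hl.1 hlm hk' (d m) (d (m * l)) (hσ m l) (hS₁ m l) (hS₂ m l)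
    (hemb m l) v hv
  have hAB : (d (m * l)).kolyvaginClass (Fact.out : p.Prime) 1 ∈
        selmerLocalKer (W.baseChange K) (v.adicCompletion K) ((p ^ 1 : ℕ) : ℤ) ↔
      (d m).kolyvaginClass (Fact.out : p.Prime) 1 ∈
        (W.baseChange K).torsionLocalKer (v.adicCompletion K) ((p ^ 1 : ℕ) : ℤ) := hA.trans hB
  rw [Nat.mul_comm m l] at hAB
  exact hAB

end Summit.BirchSwinnertonDyer.BirchSwinnertonDyer.Theorems.KolyvaginDepthDoor

end
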